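import Summits.QuantumFields.BalabanUV.Beta.GAN24.SoftColumnSupLetter
import Summits.QuantumFields.BalabanUV.Beta.GAN24.DressedOrderZeroSlotLaw

/-!
# `BalabanUV.Beta.GAN24.SoftColumnGradSupLetter` — binder row G-an2-4 ∕ (CONV-C), route R7 «TWO CURRENCIES»: THE GRADIENT SUP LETTER
# (R7-HLIP) `√(n_k^d)·‖(∇_ν M̃_k)_{X q}‖ ≤ KHg d` OF THE PHYSICAL SOFT COLUMN IS A TREE THEOREM FOR EVERY `a > 0` — every `L ≥ 1`, every
# torus, every level, constant a function of `d` ALONE — and, with leaf-03's size letter, the physical column satisfies TWO of the THREE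
# background letters of `DressedOrderZeroChain` (size, lattice Lipschitz) in exactly that file's hypothesis shapes

NOT IN PRINT; OUR PROOF ATTEMPT (prover part P3 of row G-an2-4, fibre∕strip («Woodbury») lineage, gen 26; CRUX TEAM (2), ruling «YM
REDIRECT TOWARDS THE SUMMIT», 2026-08-21).  HONEST DEPENDENCY (cell records, verbatim): «continuum YM on T⁴ ⇐ BetaPertH ∧ nine spine
estimates (0/9 proved); BetaPertH ⇐ (D1) ∧ (D4) ∧ CAP+tail; G-an2-4 gates asym, D1 and NE2/3/4.»  HONEST FRAMING (cell contract, verbatim):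
«discharging `BetaPertH` makes Bałaban's UV stability UNCONDITIONAL — a real constructive-QFT result; it is NOT the continuum limit and NOT
the Clay problem.»  ABSOLUTE RULE: nothing printed is a hypothesis; no `def … : Prop`, no sorry; [folklore] algebra over TREE objects BY NAME.

## The item and the road (leaf-03 g50's `SoftColumnSupLetter` p263836 VERBATIM, one derivative in)

leaf-03's mechanism for the SIZE letter: `a·n_k^d·𝒢_aQ_kᴴe_q = H_k·(a·Q𝒢_aQ*)e_q` ((1.103), `calG_mulVec_src_eq`), `|a·Q𝒢_aQ*| ≤ 1` entrywise
((1.100), `norm_QGQ_apply_le`), and the rows of the typed `H_k` are summable by the kernel decay `B5Hk163Torus.norm_HkOp_le`.  For the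
GRADIENT of the column the same three lines hold with `∇_νH_k` in place of `H_k`: its kernel is `B5Hk163TorusHolder.dker`
(`fdiff_HkOp_apply`) and decays with `d`-only constants on every torus (`B5Hk163TorusHolderDecay.norm_dker_bpt_le`, constant `MD163`, the typed
form of the printed sentence after (1.63) «This implies bounds on … ∂_ν(H_kB)_μ …»).
 * §1 `mulVec_src_eq` (`(A·src_q)(X) = n_k^d·(A·QBtow_kᴴ)_{X q}` for ANY `A`), `sqrt_mul_norm_fdiff_Mtil_apply`
   (`√(n_k^d)·‖(∇_νM̃_k)_{Xq}‖ = a·‖((∇_ν𝒢_k)·src_q)(X)‖`), `fdiff_calG_mulVec_src_eq` (`= (∇_νH_k·Q𝒢_aQ*)_{X, q}`);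
 * §2 `KHg d := MD163(d+1)·periodConst·(d+1)·latticeConst` (d only), **`sum_norm_fdiff_HkOp_le`** (`Σ_{q′}‖(∇_νH_k)(X,q′)‖ ≤ KHg d`),
   **`sqrt_mul_norm_fdiff_Mtil_le (k ν q X) : √(((L:ℝ)^(d+1))^k)·‖(∇_ν * Mtil k) X q‖ ≤ KHg d`** — (R7-HLIP) IN FULL, every `a > 0`;
 * §3 THE PHYSICAL COLUMN AS A BACKGROUND: `colBG q k X := √(n_k^d)·(M̃_k)_{X q}` (in `ℂ`), `fdiff_mul_apply` (entries of `∇_ν·A`), the SIZE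
   letter `norm_colBG_le : ‖colBG q k X‖ ≤ KH d` (leaf-03 BY NAME) and the LIPSCHITZ letter **`norm_colBG_sub_shiftBack_le :
   ‖colBG q k X − shiftBack n_k M μ (colBG q k) X‖ ≤ KHg d ∕ n_k`** — EXACTLY the `hW`∕`hL` hypothesis shapes of
   `DressedOrderZeroChain.norm_softDressedChain_succ_sub_le` ∕ `norm_hardDressedChain_succ_sub_le`; the third (consistency at the block
   parent, `hc`) is the sup-norm one-step rate of the column — NOT here (INTERFACE REQUEST (R7-HCONS): road P2's vector programme).

HONEST SCOPE.  [folklore] composition BY NAME of b05's typed (1.63) gradient-kernel decay, leaf-03's dictionary and NE2-P1's tower; a BOUND,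
not a rate; constant ours, `d`-only, crude; `U = 1`; NOT (CONV-C), NOT (ρ2)(ρ3), NEVER «G-an2-4 closed», NOT NE2, NOT D1, NOT BetaPertH, NOT
continuum, NOT Clay.  Locators (text only): [Balaban1984PropagatorsI] (1.63) p. 28–29, (1.100)–(1.103) p. 35, Prop. 1.1 (1.89) p. 33;
[Balaban1984PropagatorsII] (2.35) p. 228.  Provenance: prover-b2b-balaban-gan24-p3-g26-0 (unit `b2b-balaban-gan24-p3`, gen 26), 2026-08-21.
-/

noncomputable section

open scoped BigOperators ComplexConjugate Matrix Matrix.Norms.L2Operator ComplexOrder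
open Finset

namespace Summit.QuantumFields.BalabanUV.Beta.GAN24.SoftColumnGradSupLetter

open Literature.MathematicalPhysics.QuantumFieldTheory.Balaban1983to89.B5Prop11Plancherel
open Literature.MathematicalPhysics.QuantumFieldTheory.Balaban1983to89.B5G183RateUnitTower (lev lev_neZero)
open Literature.MathematicalPhysics.QuantumFieldTheory.Balaban1983to89.B4TorusKernel (periodConst)
open Literature.MathematicalPhysics.QuantumFieldTheory.Balaban1983to89.B4TorusKernel.MultiPeriod (torusSupNorm)
open Literature.MathematicalPhysics.QuantumFieldTheory.Balaban1983to89.B5Block118 (bpt QvOp)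
open Literature.MathematicalPhysics.QuantumFieldTheory.Balaban1983to89.B5Blocks16 (blockOf)
open Literature.MathematicalPhysics.QuantumFieldTheory.Balaban1983to89.B5Kernel166Decay (periodConst_pos)
open Literature.MathematicalPhysics.QuantumFieldTheory.Balaban1983to89.B4Sect5Proof (latticeConst latticeConst_nonneg)
open Literature.MathematicalPhysics.QuantumFieldTheory.Balaban1983to89.B6LowerBound2153Torus (toT rep toT_rep)
open Literature.MathematicalPhysics.QuantumFieldTheory.Balaban1983to89.B5Hk163TorusHolderRate (sum_exp_torusSupNorm_sub_rep_le)
open Literature.MathematicalPhysics.QuantumFieldTheory.Balaban1983to89.B5Hk163Strip (kappa163 kappa163_pos)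
open Literature.MathematicalPhysics.QuantumFieldTheory.Balaban1983to89.B5Hk163Torus (HkOp)
open Literature.MathematicalPhysics.QuantumFieldTheory.Balaban1983to89.B5Hk163TorusHolder (dker fdiff_HkOp_apply)
open Literature.MathematicalPhysics.QuantumFieldTheory.Balaban1983to89.B5Hk163TorusHolderDecay (MD163 norm_dker_bpt_le CHolder163_nonneg)
open Literature.MathematicalPhysics.QuantumFieldTheory.Balaban1983to89.B5Hk163Form166 (HkOp_eq_Hk)
open Literature.MathematicalPhysics.QuantumFieldTheory.Balaban1983to89.Beta.FluctuationProjection (Hk QGQ digitOf bpt_blockOf_digitOf)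
open Summit.QuantumFields.BalabanUV.T4Continuum.CovariantAveragingTower (Atow)
open Summit.QuantumFields.BalabanUV.T4Continuum.BalabanAveragedTowerUnit (idx one_le_lev' cast_lev' QBlev calGlev)
open Summit.QuantumFields.BalabanUV.T4Continuum.BalabanAveragedCoerciveTower (unitIdx)
open Summit.QuantumFields.BalabanUV.T4Continuum.BalabanMinimizerLaw
open Summit.QuantumFields.BalabanUV.Beta.GAN24.ChainLeibnizGrad (fdiff_mulVec_pt)
open Summit.QuantumFields.BalabanUV.Beta.GAN24.SoftColumnSupLetter (src KH KH_nonneg calG_mulVec_src_eq norm_QGQ_apply_le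
  sqrt_mul_norm_Mtil_le)
open Summit.QuantumFields.BalabanUV.Beta.GAN24.DressedOrderZeroSlotLaw (shiftBack)

variable {d : ℕ}

/-! ## §1 The gradient of the physical column as `∇_ν𝒢` applied to the unit source -/

section Column

variable (L : ℕ) [NeZero L] (M : Fin d → ℕ) [hM : ∀ μ, NeZero (M μ)] (a : ℝ) (ha : 0 < a)

/-- `(A·src_q)(X) = n_k^d·(A·QBtow_kᴴ)_{X q}` for ANY matrix `A` (the source is `n_k^d·conj` of the row `q` of the averaging). [folklore] -/
theorem mulVec_src_eq (k : ℕ) (q : idx L M 0) (A : Matrix (idx L M k) (idx L M k) ℂ) (X : idx L M k) :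
    (A *ᵥ src L M k q) X = (((((L : ℝ) ^ d) ^ k : ℝ)) : ℂ) * (A * (Atow (QBlev L M) k)ᴴ) X q := by
  simp only [Matrix.mulVec, dotProduct, Matrix.mul_apply, Matrix.conjTranspose_apply, src, Finset.mul_sum]
  exact Finset.sum_congr rfl fun x _ => by ring

/-- **`√(n_k^d)·‖(∇_νM̃_k)_{X q}‖ = a·‖((∇_ν𝒢_k)·src_q)(X)‖**: the gradient of the physical soft leg IS `∇_ν𝒢_a` applied to the bounded
source. [folklore] -/
theorem sqrt_mul_norm_fdiff_Mtil_apply (k : ℕ) (ν : Fin d) (q : idx L M 0) (X : idx L M k) :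
    Real.sqrt (((L : ℝ) ^ d) ^ k) * ‖(fdiff (fine (lev L k) M) ((lev L k : ℕ) : ℂ) ν * Mtil L M a ha k) X q‖
      = a * ‖((fdiff (fine (lev L k) M) ((lev L k : ℕ) : ℂ) ν * calGlev L M a ha k) *ᵥ src L M k q) X‖ := by
  have hL : (0 : ℝ) < L := by exact_mod_cast Nat.pos_of_ne_zero (NeZero.ne L)
  have hs : (0 : ℝ) ≤ ((L : ℝ) ^ d) ^ k := (pow_pos (pow_pos hL d) k).le
  have hr : 0 ≤ Real.sqrt (((L : ℝ) ^ d) ^ k) := Real.sqrt_nonneg _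
  rw [mulVec_src_eq, norm_mul, Complex.norm_real, Real.norm_of_nonneg hs, Mtil, Matrix.mul_smul, Matrix.smul_apply, smul_eq_mul, norm_mul,
    Complex.norm_real, Real.norm_of_nonneg (mul_nonneg hr ha.le), ← Matrix.mul_assoc]
  calc Real.sqrt (((L : ℝ) ^ d) ^ k) * (Real.sqrt (((L : ℝ) ^ d) ^ k) * a
        * ‖(fdiff (fine (lev L k) M) ((lev L k : ℕ) : ℂ) ν * calGlev L M a ha k * (Atow (QBlev L M) k)ᴴ) X q‖)
      = (Real.sqrt (((L : ℝ) ^ d) ^ k) * Real.sqrt (((L : ℝ) ^ d) ^ k)) * a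
          * ‖(fdiff (fine (lev L k) M) ((lev L k : ℕ) : ℂ) ν * calGlev L M a ha k * (Atow (QBlev L M) k)ᴴ) X q‖ := by ring
    _ = _ := by rw [Real.mul_self_sqrt hs]; ring

end Column

/-! ## §2 (R7-HLIP): the gradient sup letter for every `a > 0` -/

section AllA

variable (L : ℕ) [NeZero L] (M : Fin (d + 1) → ℕ) [hM : ∀ μ, NeZero (M μ)] (a : ℝ) (ha : 0 < a)

omit hM in
/-- the constant of the gradient letter: `MD163(d+1)·periodConst(κ₁₆₃(d+1), d)·(d+1)·latticeConst(d+1, κ₁₆₃(d+1)/(d+1))` — `d` ALONE. OURS.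
[folklore] -/
def KHg (d : ℕ) : ℝ :=
  MD163 (d + 1) * periodConst (kappa163 (d + 1)) d * ((d + 1) * latticeConst (d + 1) (kappa163 (d + 1) / (d + 1)))

omit hM in
/-- `0 ≤ KHg d`. [folklore] -/
theorem KHg_nonneg (d : ℕ) : 0 ≤ KHg d := by
  have h1 : 0 ≤ MD163 (d + 1) := by
    have hC : 0 ≤ Literature.MathematicalPhysics.QuantumFieldTheory.Balaban1983to89.B5Hk163Holder.CHolder163 (d + 1) 0 :=
      CHolder163_nonneg (0 : Fin (d + 1)) le_rfl zero_lt_one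
    unfold MD163; positivity
  have h2 := (periodConst_pos (kappa163_pos (d + 1)) d).le
  have h3 : (0 : ℝ) ≤ latticeConst (d + 1) (kappa163 (d + 1) / (d + 1)) :=
    latticeConst_nonneg _ (div_pos (kappa163_pos _) (by positivity)).le
  rw [KHg]; positivity

/-- **`((∇_ν𝒢_a)·src_q)(X) = (∇_νH_k·(Q𝒢_aQ*))_{X, q}`** — leaf-03's `calG_mulVec_src_eq` with one derivative outside. [folklore] -/
theorem fdiff_calG_mulVec_src_eq (k : ℕ) (ν : Fin (d + 1)) (q : idx L M 0) (X : idx L M k) :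
    ((fdiff (fine (lev L k) M) ((lev L k : ℕ) : ℂ) ν * calGlev L M a ha k) *ᵥ src L M k q) X
      = (fdiff (fine (lev L k) M) ((lev L k : ℕ) : ℂ) ν * Hk (lev L k) (one_le_lev' L k) M a ha
          * QGQ (lev L k) (one_le_lev' L k) M a ha) X (unitIdx L M q) := by
  have hcol : calGlev L M a ha k *ᵥ src L M k q
      = fun Y => (Hk (lev L k) (one_le_lev' L k) M a ha * QGQ (lev L k) (one_le_lev' L k) M a ha) Y (unitIdx L M q) :=
    funext fun Y => calG_mulVec_src_eq L M a ha k q Y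
  rw [← Matrix.mulVec_mulVec, hcol, Matrix.mul_assoc]
  simp only [Matrix.mulVec, dotProduct, Matrix.mul_apply]

/-- **the row sums of the GRADIENT of the typed `H_k` are bounded by `KHg d`**: `Σ_{q′} ‖(∇_νH_k)(X, q′)‖ ≤ KHg d` for every fine bond `X`,
every `n ≥ 1`, every torus — the gradient kernel `dker` (`B5Hk163TorusHolder.fdiff_HkOp_apply`) decays with `d`-only constants
(`B5Hk163TorusHolderDecay.norm_dker_bpt_le`), summed with `sum_exp_torusSupNorm_sub_rep_le`. [cite: Balaban1984PropagatorsI, (1.63) p.28]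
[folklore] -/
theorem sum_norm_fdiff_HkOp_le (n : ℕ) [NeZero n] (ν : Fin (d + 1)) (X : Tor (fine n M) × Fin (d + 1)) :
    ∑ q' : Tor M × Fin (d + 1), ‖(fdiff (fine n M) ((n : ℕ) : ℂ) ν * HkOp n M) X q'‖ ≤ KHg d := by
  obtain ⟨t, μ⟩ := X
  obtain ⟨r, hr⟩ : ∃ r : Fin (d + 1) → Fin n, t = bpt n M (blockOf n M t) r := ⟨digitOf n M t, (bpt_blockOf_digitOf n M t).symm⟩
  obtain ⟨x', hx'⟩ : ∃ x' : Fin (d + 1) → ℤ, blockOf n M t = toT M x' := ⟨rep M (blockOf n M t), (toT_rep _ _).symm⟩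
  have ht : t = bpt n M (toT M x') r := by rw [← hx']; exact hr
  have hκ : 0 < kappa163 (d + 1) / (d + 1) := div_pos (kappa163_pos _) (by positivity)
  set C : ℝ := MD163 (d + 1) * periodConst (kappa163 (d + 1)) d with hC
  rw [Fintype.sum_prod_type]
  calc ∑ y' : Tor M, ∑ lam : Fin (d + 1), ‖(fdiff (fine n M) ((n : ℕ) : ℂ) ν * HkOp n M) (t, μ) (y', lam)‖
      ≤ ∑ y' : Tor M, ∑ _lam : Fin (d + 1),
          C * Real.exp (-(kappa163 (d + 1) / (d + 1) * torusSupNorm M (x' - rep M y'))) := by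
        refine Finset.sum_le_sum fun y' _ => Finset.sum_le_sum fun lam _ => ?_
        have h := norm_dker_bpt_le n M μ lam ν r x' (rep M y')
        rw [toT_rep, ← ht] at h
        rw [fdiff_HkOp_apply]
        exact h
    _ = C * ((d + 1) * ∑ y' : Tor M, Real.exp (-(kappa163 (d + 1) / (d + 1) * torusSupNorm M (x' - rep M y')))) := by
        simp only [Finset.sum_const, Finset.card_univ, Fintype.card_fin, nsmul_eq_mul, Finset.mul_sum]
        refine Finset.sum_congr rfl fun y' _ => ?_
        push_cast
        ring
    _ ≤ KHg d := by
        rw [KHg, hC]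
        have hC0 : 0 ≤ MD163 (d + 1) * periodConst (kappa163 (d + 1)) d := by
          have hC : 0 ≤ Literature.MathematicalPhysics.QuantumFieldTheory.Balaban1983to89.B5Hk163Holder.CHolder163 (d + 1) 0 :=
            CHolder163_nonneg (0 : Fin (d + 1)) le_rfl zero_lt_one
          have : 0 ≤ MD163 (d + 1) := by unfold MD163; positivity
          exact mul_nonneg this (periodConst_pos (kappa163_pos _) _).le
        have hS := sum_exp_torusSupNorm_sub_rep_le M hκ x'
        have hd : (0 : ℝ) ≤ d + 1 := by positivity
        exact mul_le_mul_of_nonneg_left (mul_le_mul_of_nonneg_left hS hd) hC0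

/-- **THE GRADIENT SUP LETTER (R7-HLIP) FOR EVERY `a > 0`, UNCONDITIONALLY**: for every `a > 0`, `L ≥ 1`, torus `M`, level `k`, direction `ν`,
coarse bond `q`, fine bond `X`: `√(n_k^{d+1})·‖(∇_ν·M̃_k)_{X q}‖ ≤ KHg d` — the pointwise bound of the lattice gradient of the physical soft
column `a·n^d·𝒢_aQ_kᴴe_q`, constant a function of `d` ALONE.  MECHANISM: `∇_ν(a·n^d𝒢_aQ*e_q) = (∇_νH_k)·(a·Q𝒢_aQ*)e_q`, entries of
`a·Q𝒢_aQ*` `≤ 1` (1.100), rows of `∇_νH_k` summable uniformly (`sum_norm_fdiff_HkOp_le`). [folklore] -/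
theorem sqrt_mul_norm_fdiff_Mtil_le (k : ℕ) (ν : Fin (d + 1)) (q : idx L M 0) (X : idx L M k) :
    Real.sqrt (((L : ℝ) ^ (d + 1)) ^ k) * ‖(fdiff (fine (lev L k) M) ((lev L k : ℕ) : ℂ) ν * Mtil L M a ha k) X q‖ ≤ KHg d := by
  rw [sqrt_mul_norm_fdiff_Mtil_apply L M a ha, fdiff_calG_mulVec_src_eq L M a ha, Matrix.mul_apply]
  have hsum : ‖∑ q' : Tor M × Fin (d + 1), (fdiff (fine (lev L k) M) ((lev L k : ℕ) : ℂ) ν * Hk (lev L k) (one_le_lev' L k) M a ha) X q'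
        * QGQ (lev L k) (one_le_lev' L k) M a ha q' (unitIdx L M q)‖
      ≤ (∑ q' : Tor M × Fin (d + 1), ‖(fdiff (fine (lev L k) M) ((lev L k : ℕ) : ℂ) ν * HkOp (lev L k) M) X q'‖) * a⁻¹ := by
    rw [Finset.sum_mul, ← HkOp_eq_Hk (lev L k) (one_le_lev' L k) M a ha]
    refine (norm_sum_le _ _).trans (Finset.sum_le_sum fun q' _ => ?_)
    rw [norm_mul]
    exact mul_le_mul_of_nonneg_left (norm_QGQ_apply_le M a ha (lev L k) (one_le_lev' L k) q' _) (norm_nonneg _)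
  calc a * ‖∑ q' : Tor M × Fin (d + 1), (fdiff (fine (lev L k) M) ((lev L k : ℕ) : ℂ) ν * Hk (lev L k) (one_le_lev' L k) M a ha) X q'
          * QGQ (lev L k) (one_le_lev' L k) M a ha q' (unitIdx L M q)‖
      ≤ a * ((∑ q' : Tor M × Fin (d + 1), ‖(fdiff (fine (lev L k) M) ((lev L k : ℕ) : ℂ) ν * HkOp (lev L k) M) X q'‖) * a⁻¹) :=
        mul_le_mul_of_nonneg_left hsum ha.le
    _ = ∑ q' : Tor M × Fin (d + 1), ‖(fdiff (fine (lev L k) M) ((lev L k : ℕ) : ℂ) ν * HkOp (lev L k) M) X q'‖ := by field_simp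
    _ ≤ KHg d := sum_norm_fdiff_HkOp_le M (lev L k) ν X

/-- the gradient letter in the `∃`-binder shape (cf. `SoftColumnSupLetter.exists_hcol`): NO hypothesis. [folklore] -/
theorem exists_hgrad :
    ∃ C : ℝ, 0 ≤ C ∧ ∀ (k : ℕ) (ν : Fin (d + 1)) (q : idx L M 0) (X : idx L M k),
      Real.sqrt (((L : ℝ) ^ (d + 1)) ^ k) * ‖(fdiff (fine (lev L k) M) ((lev L k : ℕ) : ℂ) ν * Mtil L M a ha k) X q‖ ≤ C :=
  ⟨KHg d, KHg_nonneg d, sqrt_mul_norm_fdiff_Mtil_le L M a ha⟩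

/-! ## §3 The physical column as a background: the size and the Lipschitz letters of the dressed chains -/

/-- **THE PHYSICAL SOFT COLUMN AS A BACKGROUND FIELD**: `colBG q k X := √(n_k^{d+1})·(M̃_k)_{X q}` — the value at the fine bond `X` of the
unit-sourced soft leg `a·n^d·𝒢_aQ_kᴴe_q` (the `h_b = 𝓗_ke_b` of R7's vertices, soft version). [cite: Balaban1984PropagatorsI, (1.71) p.29]
[folklore] -/
def colBG (q : idx L M 0) (k : ℕ) : idx L M k → ℂ :=
  fun X => (((Real.sqrt (((L : ℝ) ^ (d + 1)) ^ k)) : ℝ) : ℂ) * Mtil L M a ha k X q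

/-- **the SIZE letter** of the column background: `‖colBG q k X‖ ≤ KH d` (leaf-03's `sqrt_mul_norm_Mtil_le` BY NAME) — the `hW` hypothesis shape
of `DressedOrderZeroChain`. [folklore] -/
theorem norm_colBG_le (q : idx L M 0) (k : ℕ) (X : idx L M k) : ‖colBG L M a ha q k X‖ ≤ KH d := by
  rw [colBG, norm_mul, Complex.norm_real, Real.norm_of_nonneg (Real.sqrt_nonneg _)]
  exact sqrt_mul_norm_Mtil_le L M a ha k q X

omit hM in
/-- entries of `∇_ν·A`: `(∇_ν·A)_{X q} = n·(A_{X+e_ν, q} − A_{X q})`. [cite: Balaban1984PropagatorsI, (1.31) p.23] [folklore] -/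
theorem fdiff_mul_apply {Nf : Fin (d + 1) → ℕ} [∀ μ, NeZero (Nf μ)] {κ : Type*} (c : ℂ) (ν : Fin (d + 1)) (A : Matrix (Tor Nf × Fin (d + 1)) κ ℂ)
    (X : Tor Nf × Fin (d + 1)) (q : κ) :
    (fdiff Nf c ν * A) X q = c * (A (X.1 + unitVec Nf ν, X.2) q - A X q) := by
  have h : (fdiff Nf c ν * A) X q = (fdiff Nf c ν *ᵥ fun Y => A Y q) X := by
    simp only [Matrix.mul_apply, Matrix.mulVec, dotProduct]
  rw [h, fdiff_mulVec_pt]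

/-- **the LIPSCHITZ letter** of the column background: `‖colBG q k X − colBG q k (X − e_μ)‖ ≤ KHg d ∕ n_k` — the `hL` hypothesis shape of
`DressedOrderZeroChain` (`shiftBack n_k M μ`), from (R7-HLIP) at the fine bond `X − e_μ`. [folklore] -/
theorem norm_colBG_sub_shiftBack_le (q : idx L M 0) (k : ℕ) (μ : Fin (d + 1)) (X : idx L M k) :
    ‖colBG L M a ha q k X - shiftBack (lev L k) M μ (colBG L M a ha q k) X‖ ≤ KHg d / (lev L k : ℕ) := by
  have hn : (0 : ℝ) < (lev L k : ℕ) := by exact_mod_cast one_le_lev' L k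
  have hnC : (((lev L k : ℕ)) : ℂ) ≠ 0 := by exact_mod_cast (Nat.pos_iff_ne_zero.mp (one_le_lev' L k))
  set Y : idx L M k := (X.1 - unitVec (fine (lev L k) M) μ, X.2) with hY
  have hXY : (Y.1 + unitVec (fine (lev L k) M) μ, Y.2) = X := by
    rw [hY]; simp only [sub_add_cancel, Prod.mk.eta]
  -- the difference is `n⁻¹·√(n^d)·(∇_μM̃)_{Y q}`
  have hg := sqrt_mul_norm_fdiff_Mtil_le L M a ha k μ q Y
  rw [fdiff_mul_apply, hXY] at hg
  have e : colBG L M a ha q k X - shiftBack (lev L k) M μ (colBG L M a ha q k) X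
      = ((((lev L k : ℕ)) : ℂ))⁻¹ * ((((Real.sqrt (((L : ℝ) ^ (d + 1)) ^ k)) : ℝ) : ℂ)
          * ((((lev L k : ℕ)) : ℂ) * (Mtil L M a ha k X q - Mtil L M a ha k Y q))) := by
    simp only [colBG, shiftBack, hY]
    field_simp
  rw [e, norm_mul, norm_inv, Complex.norm_natCast, div_eq_inv_mul]
  refine mul_le_mul_of_nonneg_left ?_ (inv_nonneg.mpr hn.le)
  rw [norm_mul, Complex.norm_real, Real.norm_of_nonneg (Real.sqrt_nonneg _)]
  exact hg

end AllA

end Summit.QuantumFields.BalabanUV.Beta.GAN24.SoftColumnGradSupLetter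

end
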